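import Literature.AnabelianGeometry.EtaleTheta.FrobenioidThetaDivisorSupport

/-!
# [EtTh] §5, Proposition 5.3: NEGATIVE companion of `DivisorSupportData` (joint unsatisfiability as typed)

Mochizuki, *The étale theta function …*, Publ. RIMS **45** (2009)
[cite: MochizukiEtTh2009, Prop 5.3 proof p.326 (PDF p.100); Prop 3.2 (i) p.296 (PDF p.70); §1 p.240 (PDF p.14)].
Seat abc-iut-L6-d1 (gen 3); proof-only companion of abc-iut-L2-d4's
`FrobenioidThetaDivisorSupport.lean` (p418923) — no declaration of that file is touched (G11:
append-only repair by a primed declaration elsewhere; the typed declaration stays as a settled negative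
edge).

WHAT IS PROVED.  For EVERY `𝔓 : DivisorPrimeData 𝔉` the structure
`FrobenioidThetaDivisors.DivisorSupportData 𝔓` is uninhabited (`DivisorSupportData.false`,
`isEmpty_divisorSupportData`).  Mechanism: field F2 types the factorization homomorphism as
`factor : Φ(A_⊚) →* Multiplicative (Primes Φ(A_⊚) →₀ ℚ)` — FINITELY supported coordinates — so that
every `x ∈ Φ(A_⊚)^gp` has order `1` at all but finitely many primes
(`ordGpOf_eq_one_of_notMem`); field F5 (`ordGp_divTheta_cusp`) asks `div(Θ̈)` to have order
`ofAdd 1` at EVERY cuspidal prime; and the cuspidal primes are infinite, since `cspToNcsp` is a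
surjection onto the non-cuspidal primes `≃ ℤ` (`infinite_setOf_isCuspidal`).
Print reads the other way: [EtTh] Prop. 3.2 (i) p.296 (PDF p.70) identifies `DIV_+(Z^log_∞)^pf` with
"a direct PRODUCT of copies of `ℚ_{≥0}`, indexed by the cusps … and irreducible components" (log-divisors
on `Ÿ_∞` may have infinite support — e.g. `div(Θ̈)` itself, Prop. 1.4 (i)), and the definition of
"cuspidally minimal" on p.326 (PDF p.100) requires the support to be "a finite set" as a CONDITION.
The minimal repair (product-valued `factor : Φ →* Multiplicative (Primes Φ → ℚ)`) is the owner's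
(abc-iut-L2-d4) or a primed `R`-file; this file only records the negative edge.
HONEST FRAMING: a statement about OUR typed structure, not about the mathematics of [EtTh]; no side
taken on anything downstream; typed ≠ proved. -/

namespace Literature.AnabelianGeometry.EtaleTheta

open CategoryTheory
open Literature.AlgebraicGeometry.Frobenioids

universe w v v' u u'

namespace FrobenioidThetaDivisors

section Orders

variable {Φ : Type w} [CommMonoid Φ]

/-- Off the (finite) support of `factor a`, the order of `a` at `𝔭` is trivial.
[cite: MochizukiEtTh2009, Prop 5.3 proof p.326 (PDF p.100)] -/
theorem ordOf_eq_one_of_notMem (factor : Φ →* Multiplicative (Primes Φ →₀ ℚ)) (a : Φ)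
    {𝔭 : Primes Φ} (h : 𝔭 ∉ (Multiplicative.toAdd (factor a)).support) :
    ordOf factor 𝔭 a = 1 := by
  rw [Finsupp.notMem_support_iff] at h
  simp only [ordOf, MonoidHom.coe_comp, Function.comp_apply,
    AddMonoidHom.toMultiplicative_apply_apply, Finsupp.applyAddHom_apply, h, ofAdd_zero]

/-- Off the supports of the two components of a fraction representing `x ∈ Φ^gp`, the order of `x`
at `𝔭` is trivial: every element of `Φ(A_⊚)^gp` has FINITE support for a finsupp-valued `factor`.
[cite: MochizukiEtTh2009, Prop 5.3 proof p.326 (PDF p.100)] -/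
theorem ordGpOf_eq_one_of_notMem (factor : Φ →* Multiplicative (Primes Φ →₀ ℚ))
    (x : Algebra.GrothendieckGroup Φ) {𝔭 : Primes Φ}
    (h₁ : 𝔭 ∉ (Multiplicative.toAdd
      (factor ((Localization.monoidOf (⊤ : Submonoid Φ)).sec x).1)).support)
    (h₂ : 𝔭 ∉ (Multiplicative.toAdd
      (factor ((Localization.monoidOf (⊤ : Submonoid Φ)).sec x).2)).support) :
    ordGpOf factor 𝔭 x = 1 := by
  rw [ordGpOf, Algebra.GrothendieckGroup.lift_apply, ordOf_eq_one_of_notMem factor _ h₁,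
    ordOf_eq_one_of_notMem factor _ h₂, div_one]

/-- Hence the support of any `x ∈ Φ^gp` is finite (contained in the union of two finsupp supports).
[cite: MochizukiEtTh2009, Prop 5.3 proof p.326 (PDF p.100)] -/
theorem suppOf_finite (factor : Φ →* Multiplicative (Primes Φ →₀ ℚ))
    (x : Algebra.GrothendieckGroup Φ) : (suppOf factor x).Finite := by
  classical
  refine (Finset.finite_toSet
    ((Multiplicative.toAdd (factor ((Localization.monoidOf (⊤ : Submonoid Φ)).sec x).1)).support ∪
      (Multiplicative.toAdd
        (factor ((Localization.monoidOf (⊤ : Submonoid Φ)).sec x).2)).support)).subset ?_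
  intro 𝔭 h𝔭
  by_contra h
  rw [Finset.coe_union, Set.mem_union, Finset.mem_coe, Finset.mem_coe, not_or] at h
  exact h𝔭 (ordGpOf_eq_one_of_notMem factor x h.1 h.2)

end Orders

variable {C : Type u} [Category.{v} C] {D : Type u'} [Category.{v'} D] {𝔉 : ThetaFrobenioid.{w} C D}

/-- The cuspidal primes of `Φ(A_⊚)` form an infinite set: `cspToNcsp` maps them ONTO the non-cuspidal
primes, which are in bijection with `ℤ` ("the natural bijection `Prime(Φ(A_⊚))^ncsp ⥲ ℤ`", "the natural
surjection `Prime(Φ(A_⊚))^csp ↠ Prime(Φ(A_⊚))^ncsp`", p.325 (PDF p.99)).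
[cite: MochizukiEtTh2009, Prop 5.3 p.325 (PDF p.99)] -/
theorem infinite_setOf_isCuspidal (𝔓 : DivisorPrimeData 𝔉) :
    {p : Primes 𝔉.PhiAcirc | 𝔓.IsCuspidal p}.Infinite := by
  have : Infinite {p : Primes 𝔉.PhiAcirc // 𝔓.IsCuspidal p} :=
    Infinite.of_surjective (fun p => 𝔓.ncspEquivZ (𝔓.cspToNcsp p))
      (𝔓.ncspEquivZ.surjective.comp 𝔓.cspToNcsp_surjective)
  exact Set.infinite_coe_iff.mp this

variable {𝔓 : DivisorPrimeData 𝔉}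

/-- **`DivisorSupportData 𝔓` is uninhabited** (for every `𝔓`): F5 (`div(Θ̈)` has order `1` at every
cuspidal prime — infinitely many) contradicts the finite support forced by the finsupp-valued F2.
[cite: MochizukiEtTh2009, Prop 5.3 proof p.326 (PDF p.100); Prop 3.2 (i) p.296 (PDF p.70)] -/
theorem DivisorSupportData.false (𝔖 : DivisorSupportData 𝔓) : False := by
  classical
  obtain ⟨𝔠, h𝔠, h𝔠S⟩ := (infinite_setOf_isCuspidal 𝔓).exists_notMem_finset
    ((Multiplicative.toAdd
      (𝔖.factor ((Localization.monoidOf (⊤ : Submonoid 𝔉.PhiAcirc)).sec 𝔓.divTheta).1)).support ∪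
      (Multiplicative.toAdd
        (𝔖.factor ((Localization.monoidOf (⊤ : Submonoid 𝔉.PhiAcirc)).sec 𝔓.divTheta).2)).support)
  rw [Finset.mem_union, not_or] at h𝔠S
  have h1 := 𝔖.ordGp_divTheta_cusp 𝔠 h𝔠
  rw [ordGpOf_eq_one_of_notMem 𝔖.factor 𝔓.divTheta h𝔠S.1 h𝔠S.2] at h1
  have h2 : Multiplicative.toAdd (1 : Multiplicative ℚ) = Multiplicative.toAdd (Multiplicative.ofAdd (1 : ℚ)) :=
    congrArg Multiplicative.toAdd h1
  rw [toAdd_one, toAdd_ofAdd] at h2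
  exact zero_ne_one h2

/-- `DivisorSupportData 𝔓` is empty, for every `𝔓 : DivisorPrimeData 𝔉`.
[cite: MochizukiEtTh2009, Prop 5.3 proof p.326 (PDF p.100)] -/
theorem isEmpty_divisorSupportData (𝔓 : DivisorPrimeData 𝔉) : IsEmpty (DivisorSupportData 𝔓) :=
  ⟨fun 𝔖 => 𝔖.false⟩

/-- Consequently every statement quantified over `𝔖 : DivisorSupportData 𝔓` holds vacuously — e.g. the
three verbatim criteria hold AND fail for every such `𝔖` (recorded so that no consumer mistakes a proof
over this binder for content).  [cite: MochizukiEtTh2009, Prop 5.3 proof p.326–327 (PDF pp.100–101)] -/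
theorem criteria_vacuous (𝔖 : DivisorSupportData 𝔓) :
    (CspToNcspCriterion 𝔖 ∧ CspToNcspWitnessed 𝔖 ∧ AdjacencyCriterion 𝔖) ∧
      ¬ (CspToNcspCriterion 𝔖 ∧ CspToNcspWitnessed 𝔖 ∧ AdjacencyCriterion 𝔖) :=
  𝔖.false.elim

end FrobenioidThetaDivisors

end Literature.AnabelianGeometry.EtaleTheta
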